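import Summits.CriticalPhenomena.PercolationContinuityZ3.Theorems.FK.RegionLawLimit
import Summits.CriticalPhenomena.PercolationContinuityZ3.Theorems.FK.InfiniteVolumeCylinders
import HarnessLib

/-!
# FK-continuity cell, FO-10a: Grimmett 2006, Thm. (4.19)(a) as printed, ALL LOCAL EVENTS — `φ^b_{Λ,p,q}(A) → φ^b_{p,q}(A)` as
# `Λ ↑ ℤ^d` along the directed set of all finite regions, for every cylinder / local event `A` (inclusion–exclusion)

Registered R100 (cell INBOX l.6824, 2026-08-24); registry row FO-10a-g339c; label RLC-A (coordinator fk-4 g205).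
Cell `fk-continuity` (bschramm), row FO-10a; support file for the FK-continuity transplant
(`--supports stmt-CriticalPhenomena-4575`); builds on p205010 (kernel theorem, internal audit signed; external expert
review pending). Pure proofs; no definitions, no named facts, no sorries; general `d` (`d ≥ 1` for the wired law).
UNCONDITIONAL infinite-volume structure; it decides nothing about FH / TP_FK / the value of `p_c(q)`.

`RegionLawLimit.lean` gives Thm. (4.19)(a) along `atTop : Filter (Finset (Site d))` for INCREASING (and decreasing) local
events — Grimmett's monotonicity argument (4.24). The passage "to all cylinder events" (Grimmett 2006, proof of Thm. (4.19)(a):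
the increasing cylinders `{E₀ ⊆ ω}` determine every cylinder probability by inclusion–exclusion) is in the tree for SEQUENCES
of measures with unidentified limits (`InfiniteVolumeCylinders.tendsto_measureReal_of_isLocalEvent_of_supset`, `ℕ`-indexed);
here it is redone along an ARBITRARY filter with the limit identified, and applied to the region laws:

* `tendsto_measureReal_cylEvent_of_tendsto_setOf_subset` — along any filter `l`: if `ν_i{E₀ ⊆ ω} → P{E₀ ⊆ ω}` for every
  `E₀ ⊆ F`, then `ν_i(C(F',S)) → P(C(F',S))` for all cylinders with `S ⊆ F' ⊆ F` (one coordinate at a time);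
* `tendsto_measureReal_of_determinedBy_of_tendsto_setOf_subset` — hence `ν_i(A) → P(A)` for every event `A` determined by `F`;
* **`tendsto_regionFreeReal_atTop_of_isLocalEvent`** — `φ⁰_{Λ,p,q}(A) → φ⁰_{p,q}(A)` along the directed set of regions for EVERY
  local event `A` (`p ∈ [0,1]`, `q ≥ 1`); **`tendsto_regionWiredReal_atTop_of_determinedBy`** — `φ¹_{Λ,p,q}(A) → φ¹_{p,q}(A)` for
  every event determined by the edges of a finite region (`d ≥ 1`); `…_comp_of_tendsto_atTop` ×2 — along every exhausting sequence.

Honest framing: infinite-volume bookkeeping; no statement about `p_c(q)`; NOT a binder discharge, NOT `_r4`.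

## References

* G. Grimmett, *The Random-Cluster Model*, Springer 2006 (`book:grimmett2006-random-cluster-model`): Thm. (4.19)(a) and its
  proof (increasing cylinders, then all cylinder events), §4.1 [PDF pp. 77–79]. [Grimmett2006]
-/

noncomputable section

open Finset Filter Topology MeasureTheory

namespace Summit.CriticalPhenomena.PercolationContinuityZ3.Theorems.FK

open Literature.Probability.Percolation Literature.Probability.LatticeModels

/-! ### Inclusion–exclusion along an arbitrary filter, limit identified -/

section Generic

variable {ι κ : Type*} {l : Filter κ}

/-- **One coordinate at a time, along any filter.** If the increasing-cylinder probabilities `ν_i{E₀ ⊆ ω}` converge to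
`P{E₀ ⊆ ω}` for every `E₀ ⊆ F`, then `ν_i(C(F', S)) → P(C(F', S))` for every cylinder event with `S ⊆ F' ⊆ F`.
[cite: Grimmett2006, Thm. (4.19)(a), proof] -/
theorem tendsto_measureReal_cylEvent_of_tendsto_setOf_subset (νs : κ → Measure (Set ι)) (P : Measure (Set ι))
    [IsFiniteMeasure P] (hfin : ∀ i, IsFiniteMeasure (νs i)) (F : Finset ι)
    (h : ∀ E₀ : Finset ι, E₀ ⊆ F →
      Tendsto (fun i => (νs i).real {ω | (↑E₀ : Set ι) ⊆ ω}) l (𝓝 (P.real {ω | (↑E₀ : Set ι) ⊆ ω})))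
    {F' S : Finset ι} (hF' : F' ⊆ F) (hS : S ⊆ F') :
    Tendsto (fun i => (νs i).real (cylEvent F' S)) l (𝓝 (P.real (cylEvent F' S))) := by
  classical
  -- induction on the number `|F' ∖ S|` of coordinates prescribed absent
  suffices H : ∀ k : ℕ, ∀ F' S : Finset ι, F' ⊆ F → S ⊆ F' → (F' \ S).card = k →
      Tendsto (fun i => (νs i).real (cylEvent F' S)) l (𝓝 (P.real (cylEvent F' S))) from
    H _ F' S hF' hS rfl
  intro k
  induction k with
  | zero =>
    intro F' S hF' hS hk
    rw [Finset.card_eq_zero, Finset.sdiff_eq_empty_iff_subset] at hk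
    rw [cylEvent_eq_setOf_subset hk]
    exact h F' hF'
  | succ k ih =>
    intro F' S hF' hS hk
    obtain ⟨e₀, he₀⟩ : (F' \ S).Nonempty := by
      rw [← Finset.card_pos, hk]
      exact Nat.succ_pos k
    rw [Finset.mem_sdiff] at he₀
    obtain ⟨he₀E, he₀S⟩ := he₀
    have hk1 : (F'.erase e₀ \ S).card = k := by
      rw [Finset.erase_sdiff_comm, Finset.card_erase_of_mem (Finset.mem_sdiff.2 ⟨he₀E, he₀S⟩), hk]
      rfl
    have hk2 : (F' \ insert e₀ S).card = k := by
      rw [Finset.sdiff_insert, Finset.card_erase_of_mem (Finset.mem_sdiff.2 ⟨he₀E, he₀S⟩), hk]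
      rfl
    have hS1 : S ⊆ F'.erase e₀ := fun e he => Finset.mem_erase.2 ⟨fun hee => he₀S (hee ▸ he), hS he⟩
    have h1 := ih (F'.erase e₀) S ((Finset.erase_subset _ _).trans hF') hS1 hk1
    have h2 := ih F' (insert e₀ S) hF' (Finset.insert_subset he₀E hS) hk2
    have heq : ∀ μ : Measure (Set ι), IsFiniteMeasure μ → μ.real (cylEvent F' S) =
        μ.real (cylEvent (F'.erase e₀) S) - μ.real (cylEvent F' (insert e₀ S)) := by
      intro μ hμ
      rw [cylEvent_erase_eq_union he₀S,
        measureReal_union (disjoint_cylEvent_insert he₀E he₀S) (measurableSet_cylEvent _ _)]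
      ring
    rw [heq P inferInstance]
    simp_rw [fun i => heq (νs i) (hfin i)]
    exact h1.sub h2

/-- **From increasing cylinders to every event determined by `F`, along any filter.** If `ν_i{E₀ ⊆ ω} → P{E₀ ⊆ ω}` for every
`E₀ ⊆ F` then `ν_i(A) → P(A)` for every event `A` determined by `F` (a disjoint union of the cylinders `C(F,S)` it contains).
[cite: Grimmett2006, Thm. (4.19)(a), proof] -/
theorem tendsto_measureReal_of_determinedBy_of_tendsto_setOf_subset (νs : κ → Measure (Set ι)) (P : Measure (Set ι))
    [IsFiniteMeasure P] (hfin : ∀ i, IsFiniteMeasure (νs i)) (F : Finset ι)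
    (h : ∀ E₀ : Finset ι, E₀ ⊆ F →
      Tendsto (fun i => (νs i).real {ω | (↑E₀ : Set ι) ⊆ ω}) l (𝓝 (P.real {ω | (↑E₀ : Set ι) ⊆ ω})))
    {A : Set (Set ι)} (hA : DeterminedBy A ↑F) :
    Tendsto (fun i => (νs i).real A) l (𝓝 (P.real A)) := by
  classical
  have hF := (determinedBy_iff _ _).1 hA
  set T : Finset (Finset ι) := F.powerset.filter fun S => ((S : Set ι) ∈ A) with hT
  -- decomposition of `A` into the cylinders it contains
  have hdec : A = ⋃ S ∈ T, cylEvent F S := by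
    ext ω
    simp only [Set.mem_iUnion, hT, Finset.mem_filter, Finset.mem_powerset, exists_prop]
    constructor
    · intro hω
      refine ⟨F.filter (· ∈ ω), ⟨Finset.filter_subset _ _, ?_⟩, ?_⟩
      · refine (hF ω _ ?_).1 hω
        ext e
        simp only [Set.mem_inter_iff, Finset.mem_coe, Finset.coe_filter, Set.mem_setOf_eq]
        tauto
      · rw [mem_cylEvent_iff]
        intro e he
        simp only [Finset.mem_filter]
        tauto
    · rintro ⟨S, ⟨-, hSA⟩, hω⟩
      rw [mem_cylEvent_iff] at hω
      refine (hF ω S ?_).2 hSA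
      ext e
      simp only [Set.mem_inter_iff, Finset.mem_coe]
      exact ⟨fun h' => ⟨(hω e h'.2).1 h'.1, h'.2⟩, fun h' => ⟨(hω e h'.2).2 h'.1, h'.2⟩⟩
  have hdisj : (T : Set (Finset ι)).PairwiseDisjoint fun S => cylEvent F S := by
    intro S hS S' hS' hne
    have hSF : S ⊆ F := Finset.mem_powerset.1 (Finset.mem_filter.1 hS).1
    have hS'F : S' ⊆ F := Finset.mem_powerset.1 (Finset.mem_filter.1 hS').1
    exact disjoint_cylEvent_of_ne hSF hS'F hne
  have hsum : ∀ μ : Measure (Set ι), IsFiniteMeasure μ → μ.real A = ∑ S ∈ T, μ.real (cylEvent F S) := by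
    intro μ hμ
    rw [hdec]
    exact measureReal_biUnion_finset hdisj fun S _ => measurableSet_cylEvent F S
  rw [hsum P inferInstance]
  simp_rw [fun i => hsum (νs i) (hfin i)]
  refine tendsto_finsetSum _ fun S hS => ?_
  have hSF : S ⊆ F := Finset.mem_powerset.1 (Finset.mem_filter.1 hS).1
  exact tendsto_measureReal_cylEvent_of_tendsto_setOf_subset νs P hfin F h le_rfl hSF

end Generic

/-! ### The region laws on all local events -/

section Regions

variable {d : ℕ}

/-- **Grimmett 2006, Thm. (4.19)(a), free boundary condition, ALL LOCAL EVENTS**: for `p ∈ [0,1]`, `q ≥ 1` and every local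
event `A`, `φ⁰_{Λ,p,q}(A) → φ⁰_{p,q}(A)` as `Λ ↑ ℤ^d` along the directed set of all finite regions.
[cite: Grimmett2006, Thm. (4.19)(a)] -/
theorem tendsto_regionFreeReal_atTop_of_isLocalEvent {p q : ℝ} (hp : p ∈ Set.Icc (0 : ℝ) 1) (hq : 1 ≤ q)
    {A : Set (BondConfig (Site d))} (hA : IsLocalEvent A) :
    Tendsto (fun Λ : Finset (Site d) => regionFreeReal d p q Λ A) atTop (𝓝 ((rcLimit d false p q).real A)) := by
  obtain ⟨F, hAF⟩ := hA
  have hq0 : 0 < q := one_pos.trans_le hq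
  haveI := isProbabilityMeasure_rcLimit (d := d) false p q
  -- the free region laws as measures on the lattice configurations
  set νs : Finset (Site d) → Measure (BondConfig (Site d)) := fun Λ =>
    (rcMeasure (finsetGraph (zdGraph d) Λ) p q ∅).map (liftEdges Λ) with hνs
  have hfin : ∀ Λ, IsFiniteMeasure (νs Λ) := fun Λ => by
    haveI := isProbabilityMeasure_rcMeasure (finsetGraph (zdGraph d) Λ) hp hq0 (∅ : Set ↥Λ)
    exact inferInstance
  have hreal : ∀ Λ, ∀ {B : Set (BondConfig (Site d))}, MeasurableSet B → (νs Λ).real B = regionFreeReal d p q Λ B :=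
    fun Λ B hB => by rw [hνs, map_measureReal_apply (measurable_of_finite _) hB]; rfl
  have h := tendsto_measureReal_of_determinedBy_of_tendsto_setOf_subset νs (rcLimit d false p q) hfin F
    (fun E₀ _ => by
      simp_rw [hreal _ (measurableSet_setOf_subset E₀)]
      exact tendsto_regionFreeReal_atTop hp hq (isLocalEvent_setOf_subset E₀) (isUpperSet_setOf_finset_subset E₀)) hAF
  simp_rw [hreal _ hAF.measurableSet_of_finset] at h
  exact h

/-- **Grimmett 2006, Thm. (4.19)(a), wired boundary condition, ALL LOCAL EVENTS**: for `d ≥ 1`, `p ∈ [0,1]`, `q ≥ 1` and every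
event `A` determined by the edges of a finite region `Λ₀`, `φ¹_{Λ,p,q}(A) → φ¹_{p,q}(A)` as `Λ ↑ ℤ^d` along the directed set of
all finite regions. [cite: Grimmett2006, Thm. (4.19)(a)] -/
theorem tendsto_regionWiredReal_atTop_of_determinedBy (hd : 0 < d) {p q : ℝ} (hp : p ∈ Set.Icc (0 : ℝ) 1) (hq : 1 ≤ q)
    {A : Set (BondConfig (Site d))} {Λ₀ : Finset (Site d)} (hA : DeterminedBy A ↑(edgesIn (zdGraph d) Λ₀)) :
    Tendsto (fun Λ : Finset (Site d) => regionWiredReal d p q Λ A) atTop (𝓝 ((rcLimit d true p q).real A)) := by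
  have hq0 : 0 < q := one_pos.trans_le hq
  haveI := isProbabilityMeasure_rcLimit (d := d) true p q
  set νs : Finset (Site d) → Measure (BondConfig (Site d)) := fun Λ =>
    (rcMeasure (finsetGraph (zdGraph d) Λ) p q (wiredBoundary (zdGraph d) Λ)).map (liftEdges Λ) with hνs
  have hfin : ∀ Λ, IsFiniteMeasure (νs Λ) := fun Λ => by
    haveI := isProbabilityMeasure_rcMeasure (finsetGraph (zdGraph d) Λ) hp hq0 (wiredBoundary (zdGraph d) Λ)
    exact inferInstance
  have hreal : ∀ Λ, ∀ {B : Set (BondConfig (Site d))}, MeasurableSet B → (νs Λ).real B = regionWiredReal d p q Λ B :=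
    fun Λ B hB => by rw [hνs, map_measureReal_apply (measurable_of_finite _) hB]; rfl
  have h := tendsto_measureReal_of_determinedBy_of_tendsto_setOf_subset νs (rcLimit d true p q) hfin
    (edgesIn (zdGraph d) Λ₀)
    (fun E₀ hE₀ => by
      simp_rw [hreal _ (measurableSet_setOf_subset E₀)]
      have hdet : DeterminedBy {ω : BondConfig (Site d) | (↑E₀ : Set (Sym2 (Site d))) ⊆ ω} ↑(edgesIn (zdGraph d) Λ₀) :=
        (determinedBy_setOf_subset E₀).mono (Finset.coe_subset.2 hE₀)
      exact tendsto_regionWiredReal_atTop hd hp hq hdet (isUpperSet_setOf_finset_subset E₀)) hA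
  simp_rw [hreal _ hA.measurableSet_of_finset] at h
  exact h

/-- Along every exhausting sequence of regions (`Λ_n → atTop`), the free region laws of every local event converge to
`φ⁰_{p,q}`. [cite: Grimmett2006, Thm. (4.19)(a)] -/
theorem tendsto_regionFreeReal_comp_of_isLocalEvent {ι : Type*} {l : Filter ι} {Λs : ι → Finset (Site d)}
    (hΛ : Tendsto Λs l atTop) {p q : ℝ} (hp : p ∈ Set.Icc (0 : ℝ) 1) (hq : 1 ≤ q)
    {A : Set (BondConfig (Site d))} (hA : IsLocalEvent A) :
    Tendsto (fun i => regionFreeReal d p q (Λs i) A) l (𝓝 ((rcLimit d false p q).real A)) :=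
  (tendsto_regionFreeReal_atTop_of_isLocalEvent hp hq hA).comp hΛ

/-- Along every exhausting sequence of regions, the wired region laws of every event determined inside a finite region converge
to `φ¹_{p,q}` (`d ≥ 1`). [cite: Grimmett2006, Thm. (4.19)(a)] -/
theorem tendsto_regionWiredReal_comp_of_determinedBy {ι : Type*} {l : Filter ι} {Λs : ι → Finset (Site d)}
    (hΛ : Tendsto Λs l atTop) (hd : 0 < d) {p q : ℝ} (hp : p ∈ Set.Icc (0 : ℝ) 1) (hq : 1 ≤ q)
    {A : Set (BondConfig (Site d))} {Λ₀ : Finset (Site d)} (hA : DeterminedBy A ↑(edgesIn (zdGraph d) Λ₀)) :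
    Tendsto (fun i => regionWiredReal d p q (Λs i) A) l (𝓝 ((rcLimit d true p q).real A)) :=
  (tendsto_regionWiredReal_atTop_of_determinedBy hd hp hq hA).comp hΛ

end Regions

end Summit.CriticalPhenomena.PercolationContinuityZ3.Theorems.FK
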